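import Summits.HodgeConjecture.CorCM.IrreducibleOddWeightsIsotypicFrobeniusRank
import HarnessLib

/-!
# Isotypic cells, Frobenius V: CM FIELDS — the multiplicity of an `Aut(ℂ)`-irreducible `A_c` in `ℚ^{Hom(K_i, ℂ)}`
# is `dim A_c^{Aut(ℂ/x_i K_i)}/δ_c`; `[K_i : ℚ] = Σ_c (dim A_c^{H_i}/δ_c)·dim A_c`; `A_{Φ_i}` is nondegenerate
# iff in every odd class the components of `u_i` span `dim A_c^{H_i}` dimensions over `𝒟_c`

COR-CM (cell `pub-hodgecm2`, binder seat `b16` gen 77, count-neutral claim FROBENIUS RECIPROCITY IN THE REFERENCE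
CURRENCY — MULTIPLICITIES FROM FIXED POINTS, file R5 — the CM dress of files R3/R4; theorems only, no definition,
no named fact, no `sorry`).  NEW as stated, hence under `Summits/`.  HONEST FRAMING: for number fields `K_i`
the slots `Hom(K_i, ℂ)` are single `Aut(ℂ)`-orbits (tree `Pohlmann1968.isPretransitive_ringEquiv_complex`), so
files R3/R4 apply with `x₀ = x_i` any embedding and `H_i = Stab(x_i) = Aut(ℂ/x_i K_i)` (the automorphisms of `ℂ`
fixing `x_i(K_i)` pointwise, `smul_embedding_eq_self_iff`): the multiplicity `m_{i,c}` of a reference irreducible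
`A_c` in `ℚ^{Hom(K_i, ℂ)}` is `dim A_c^{H_i}/δ_c` (Lange–Rodríguez Lemma 2.8.1 over `ℚ`), `[K_i : ℚ] =
Σ_c (dim A_c^{H_i}/δ_c)·dim A_c`, and — for CM fields and CM types `Φ_i` — gen 76 E10's nondegeneracy criterion
reads **`A_{Φ_i}` nondegenerate ⟺ in every ODD class `dim D_c⟨b^i_c⟩ = dim A_c^{H_i}`**.  "Rank / nondegeneracy
of CM types for NAMED configurations" (kernel, unconditional) for INT-4 «what is known»; nothing about Hodge
classes is asserted, `HC_CM` is neither used nor asserted.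

* §1 `exists_smul_embedding_eq` (one orbit), `smul_embedding_eq_self_iff` (the stabiliser of `x₀` is
  `Aut(ℂ/x₀K)`).
* §2 **`exists_isotypic_card_mul_eq_finrank_fixed`** (number fields `K_i`): an isotypic decomposition of
  `⊕_i ℚ^{Hom(K_i, ℂ)}` over pairwise non-embeddable `Aut(ℂ)`-irreducibles `A_c` with, for every `i`, every base
  embedding `x₀ : K_i → ℂ` and the fixed subspace `F` of its stabiliser: **`m_{i,c}·δ_c = dim(A_c ⊓ F)`** and
  **`[K_i : ℚ] = Σ_c (dim(A_c ⊓ F)/δ_c)·dim A_c`**.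
* §3 **`exists_isotypic_isNondegenerate_iff_forall_odd_finrank_fixed`** (CM fields, CM types `Φ_i`): an isotypic
  decomposition of the type vectors with, for every `i`, `x₀`, `F` as above:
  **`IsNondegenerate Φ_i ⟺ ∀ c` with `A_c` odd under complex conjugation, `dim ⨆_j 𝒟_c·b^i_{c,j} = dim(A_c ⊓ F)`**.

## References

* [LangeRodriguez2022] H. Lange, R. E. Rodríguez, *Decomposition of Jacobians by Prym Varieties*, LNM 2310 (2022),
  §2.8 Lemma 2.8.1.
* [Kubota1965] T. Kubota, *On the field extension by complex multiplication*, Trans. AMS 118 (1965), §2 Lemma 2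
  and p. 115.
* [Mai1989] L. Mai, *Lower bounds for the ranks of CM types*, J. Number Theory 32 (1989), §2 Prop. 1.
* [Dodson1987] B. Dodson, *On the Mumford–Tate group of an abelian variety with complex multiplication*,
  J. Algebra 111 (1987), §1.1.
* [Gordon1999HodgeAVSurvey] B. B. Gordon, *A survey of the Hodge conjecture for abelian varieties*, §9.2 (proof:
  `Aut(ℂ)` acts through `Gal(L/ℚ)` on the embeddings).
-/

set_option autoImplicit false

noncomputable section

open scoped BigOperators Classical

namespace Summit.HodgeConjecture.CorCM

open NumberField
open Literature.NumberTheory.ComplexMultiplication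
open Literature.AlgebraicGeometry.Motives (CMType)
open Literature.AlgebraicGeometry.Pohlmann1968

/-! ### §1 The slot `Hom(K, ℂ)`: one `Aut(ℂ)`-orbit; the stabiliser of an embedding -/

section Slot

variable {K : Type} [Field K] [NumberField K]

/-- **`Hom(K, ℂ)` IS ONE `Aut(ℂ)`-ORBIT**: for embeddings `x₀, x : K → ℂ` there is `g ∈ Aut(ℂ)` with
`g ∘ x₀ = x` (tree `isPretransitive_ringEquiv_complex`). [cite: Gordon1999HodgeAVSurvey, §9.2 (proof)] -/
theorem exists_smul_embedding_eq (x₀ x : K →+* ℂ) : ∃ g : ℂ ≃+* ℂ, g • x₀ = x := by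
  haveI := isPretransitive_ringEquiv_complex (K := K)
  exact MulAction.exists_smul_eq (ℂ ≃+* ℂ) x₀ x

omit [NumberField K] in
/-- **THE STABILISER OF AN EMBEDDING IS `Aut(ℂ/x₀K)`**: `k • x₀ = x₀` iff `k` fixes `x₀(K)` pointwise. [folklore] -/
theorem smul_embedding_eq_self_iff (k : ℂ ≃+* ℂ) (x₀ : K →+* ℂ) :
    k • x₀ = x₀ ↔ ∀ a : K, k (x₀ a) = x₀ a := by
  rw [ringEquiv_smul_def, RingHom.ext_iff]
  exact Iff.rfl

end Slot

/-! ### §2 Number fields: the multiplicities of `⊕_i ℚ^{Hom(K_i, ℂ)}` read off the stabilisers -/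

variable {I : Type} [Fintype I] {K : I → Type} [∀ i, Field (K i)] [∀ i, NumberField (K i)]

/-- **THE MULTIPLICITIES OF THE `Aut(ℂ)`-ISOTYPIC DECOMPOSITION OF `⊕_i ℚ^{Hom(K_i, ℂ)}` ARE READ OFF THE
STABILISERS.**  For number fields `K_i` (`i ∈ I` finite) there is an isotypic decomposition `ℚ^{Hom(K_i, ℂ)} ≅
⊕_c A_c^{m_{i,c}}` over pairwise non-embeddable `Aut(ℂ)`-stable irreducible non-zero `A_c ≤ ℚ^{⊔_i Hom(K_i, ℂ)}`
(commutants `𝒟_c`, equivariant embeddings injective on `A_c` with independent images spanning each slot, non-zero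
`a₀_c ∈ A_c`, `δ_c = dim 𝒟_c·a₀_c`) such that for EVERY `i`, every base embedding `x₀ : K_i → ℂ` and the fixed
subspace `F` of its stabiliser `Aut(ℂ/x₀K_i)`: **`m_{i,c}·δ_c = dim(A_c ⊓ F)`** for all `c`, and
**`[K_i : ℚ] = Σ_c (dim(A_c ⊓ F)/δ_c)·dim A_c`**. [cite: LangeRodriguez2022, §2.8 Lemma 2.8.1]
[cite: Gordon1999HodgeAVSurvey, §9.2 (proof)] -/
theorem exists_isotypic_card_mul_eq_finrank_fixed :
    ∃ (n : ℕ) (Ar : Fin n → Submodule ℚ ((Σ i, (K i →+* ℂ)) → ℚ))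
      (𝒟 : Fin n → Submodule ℚ (((Σ i, (K i →+* ℂ)) → ℚ) →ₗ[ℚ] ((Σ i, (K i →+* ℂ)) → ℚ)))
      (m : I → Fin n → ℕ)
      (ι : ∀ (i : I) (c : Fin n), Fin (m i c) → (((Σ i, (K i →+* ℂ)) → ℚ) →ₗ[ℚ] ((K i →+* ℂ) → ℚ)))
      (a₀ : Fin n → ((Σ i, (K i →+* ℂ)) → ℚ)),
      (∀ (c : Fin n) (L : ((Σ i, (K i →+* ℂ)) → ℚ) →ₗ[ℚ] ((Σ i, (K i →+* ℂ)) → ℚ)), L ∈ 𝒟 c ↔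
        (∀ a ∈ Ar c, L a ∈ Ar c) ∧ ∀ (k : ℂ ≃+* ℂ) (a : (Σ i, (K i →+* ℂ)) → ℚ), a ∈ Ar c →
          L (fun x => a (k • x)) = fun x => L a (k • x)) ∧
      (∀ (c : Fin n) (k : ℂ ≃+* ℂ) (a : (Σ i, (K i →+* ℂ)) → ℚ), a ∈ Ar c → (fun x => a (k • x)) ∈ Ar c) ∧
      (∀ (c : Fin n) (W : Submodule ℚ ((Σ i, (K i →+* ℂ)) → ℚ)), W ≤ Ar c → W ≠ ⊥ →
        (∀ (k : ℂ ≃+* ℂ) (f : (Σ i, (K i →+* ℂ)) → ℚ), f ∈ W → (fun x => f (k • x)) ∈ W) → W = Ar c) ∧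
      (∀ c : Fin n, Ar c ≠ ⊥) ∧
      (∀ (c c' : Fin n) (L : ((Σ i, (K i →+* ℂ)) → ℚ) →ₗ[ℚ] ((Σ i, (K i →+* ℂ)) → ℚ)), c ≠ c' → Ar c ≠ ⊥ →
        (∀ a ∈ Ar c, L a ∈ Ar c') → (∀ a ∈ Ar c, L a = 0 → a = 0) →
        (∀ (k : ℂ ≃+* ℂ) (a : (Σ i, (K i →+* ℂ)) → ℚ), a ∈ Ar c →
          L (fun x => a (k • x)) = fun x => L a (k • x)) → False) ∧
      (∀ (i : I) (c : Fin n) (j : Fin (m i c)) (k : ℂ ≃+* ℂ) (a : (Σ i, (K i →+* ℂ)) → ℚ), a ∈ Ar c →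
        ι i c j (fun x => a (k • x)) = fun s => ι i c j a (k • s)) ∧
      (∀ (i : I) (c : Fin n) (j : Fin (m i c)) (a : (Σ i, (K i →+* ℂ)) → ℚ), a ∈ Ar c →
        ι i c j a = 0 → a = 0) ∧
      (∀ i : I, iSupIndep fun q : (Σ c : Fin n, Fin (m i c)) => (Ar q.1).map (ι i q.1 q.2)) ∧
      (∀ i : I, (⨆ c : Fin n, ⨆ j : Fin (m i c), (Ar c).map (ι i c j)) = ⊤) ∧
      (∀ c, a₀ c ∈ Ar c) ∧ (∀ c, a₀ c ≠ 0) ∧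
      ∀ (i : I) (x₀ : K i →+* ℂ) (F : Submodule ℚ ((Σ i, (K i →+* ℂ)) → ℚ)),
        (∀ f : (Σ i, (K i →+* ℂ)) → ℚ, f ∈ F ↔
          ∀ k : ℂ ≃+* ℂ, k • x₀ = x₀ → (fun y => f (k • y)) = f) →
        (∀ c, m i c * Module.finrank ℚ ↥((𝒟 c).map (LinearMap.applyₗ (a₀ c))) =
          Module.finrank ℚ ↥(Ar c ⊓ F)) ∧
        Module.finrank ℚ (K i) = ∑ c, Module.finrank ℚ ↥(Ar c ⊓ F) /
          Module.finrank ℚ ↥((𝒟 c).map (LinearMap.applyₗ (a₀ c))) * Module.finrank ℚ (Ar c) := by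
  obtain ⟨n, Ar, 𝒟, m, ι, a₀, h𝒟, hRst, hRirr, hR0, hsep, hιeq, hinj, hindep, htop, ha₀, h0, hfrob⟩ :=
    IrrOdd.exists_isotypic_card_mul_eq_finrank_inf (G := ℂ ≃+* ℂ) (E := fun i => K i →+* ℂ)
  refine ⟨n, Ar, 𝒟, m, ι, a₀, h𝒟, hRst, hRirr, hR0, hsep, hιeq, hinj, hindep, htop, ha₀, h0,
    fun i x₀ F hF => ?_⟩
  obtain ⟨h1, h2⟩ := hfrob i x₀ (exists_smul_embedding_eq x₀) F hF
  refine ⟨h1, ?_⟩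
  rw [← Embeddings.card (K i) ℂ]
  exact h2

/-! ### §3 CM fields: nondegeneracy class by class with the multiplicities read off the stabilisers -/

variable [∀ i, IsCMField (K i)]

/-- **NONDEGENERACY OF CM ABELIAN VARIETIES CLASS BY CLASS, THE MULTIPLICITIES READ OFF THE STABILISERS.**  For CM
fields `K_i` and CM types `Φ_i` there is an isotypic decomposition of the type vectors `u_i = 𝟙_{Φ_i} − 𝟙_{Φ̄_i}`
over pairwise non-embeddable `Aut(ℂ)`-stable irreducibles `A_c ≤ ℚ^{⊔_i Hom(K_i, ℂ)}` (commutants `𝒟_c`,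
multiplicities `m_{i,c}`, components `b^i_{c,j}`, non-zero `a₀_c ∈ A_c`) such that for EVERY `i`, every base
embedding `x₀ : K_i → ℂ` and the fixed subspace `F` of its stabiliser `Aut(ℂ/x₀K_i)` in `ℚ^{⊔_i Hom(K_i, ℂ)}`:
**`A_{Φ_i}` is NONDEGENERATE (`IsNondegenerate Φ_i`: `dim Hg(A_{Φ_i}) = dim A_{Φ_i}`) iff for every class `c` with
`A_c` ODD under complex conjugation, `dim ⨆_j 𝒟_c·b^i_{c,j} = dim(A_c ⊓ F)`** — the components of every odd class
span over `𝒟_c` as many dimensions as `A_c` has `Aut(ℂ/x₀K_i)`-invariants (gen 76 E10's `= m_{i,c}·δ_c` with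
`m_{i,c}·δ_c = dim(A_c ⊓ F)` by Frobenius reciprocity, file R3). [cite: Kubota1965, §2 Lemma 2 and p. 115]
[cite: Mai1989, §2 Prop. 1] [cite: Dodson1987, §1.1] [cite: LangeRodriguez2022, §2.8 Lemma 2.8.1] -/
theorem exists_isotypic_isNondegenerate_iff_forall_odd_finrank_fixed (Φ : ∀ i, CMType (K i)) :
    ∃ (n : ℕ) (Ar : Fin n → Submodule ℚ ((Σ i, (K i →+* ℂ)) → ℚ))
      (𝒟 : Fin n → Submodule ℚ (((Σ i, (K i →+* ℂ)) → ℚ) →ₗ[ℚ] ((Σ i, (K i →+* ℂ)) → ℚ)))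
      (m : I → Fin n → ℕ)
      (ι : ∀ (i : I) (c : Fin n), Fin (m i c) → (((Σ i, (K i →+* ℂ)) → ℚ) →ₗ[ℚ] ((K i →+* ℂ) → ℚ)))
      (b : ∀ (i : I) (c : Fin n), Fin (m i c) → ((Σ i, (K i →+* ℂ)) → ℚ))
      (a₀ : Fin n → ((Σ i, (K i →+* ℂ)) → ℚ)),
      (∀ (c : Fin n) (L : ((Σ i, (K i →+* ℂ)) → ℚ) →ₗ[ℚ] ((Σ i, (K i →+* ℂ)) → ℚ)), L ∈ 𝒟 c ↔
        (∀ a ∈ Ar c, L a ∈ Ar c) ∧ ∀ (k : ℂ ≃+* ℂ) (a : (Σ i, (K i →+* ℂ)) → ℚ), a ∈ Ar c →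
          L (fun x => a (k • x)) = fun x => L a (k • x)) ∧
      (∀ (c : Fin n) (k : ℂ ≃+* ℂ) (a : (Σ i, (K i →+* ℂ)) → ℚ), a ∈ Ar c → (fun x => a (k • x)) ∈ Ar c) ∧
      (∀ (c : Fin n) (W : Submodule ℚ ((Σ i, (K i →+* ℂ)) → ℚ)), W ≤ Ar c → W ≠ ⊥ →
        (∀ (k : ℂ ≃+* ℂ) (f : (Σ i, (K i →+* ℂ)) → ℚ), f ∈ W → (fun x => f (k • x)) ∈ W) → W = Ar c) ∧
      (∀ c : Fin n, Ar c ≠ ⊥) ∧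
      (∀ (c c' : Fin n) (L : ((Σ i, (K i →+* ℂ)) → ℚ) →ₗ[ℚ] ((Σ i, (K i →+* ℂ)) → ℚ)), c ≠ c' → Ar c ≠ ⊥ →
        (∀ a ∈ Ar c, L a ∈ Ar c') → (∀ a ∈ Ar c, L a = 0 → a = 0) →
        (∀ (k : ℂ ≃+* ℂ) (a : (Σ i, (K i →+* ℂ)) → ℚ), a ∈ Ar c →
          L (fun x => a (k • x)) = fun x => L a (k • x)) → False) ∧
      (∀ (i : I) (c : Fin n) (j : Fin (m i c)) (k : ℂ ≃+* ℂ) (a : (Σ i, (K i →+* ℂ)) → ℚ), a ∈ Ar c →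
        ι i c j (fun x => a (k • x)) = fun s => ι i c j a (k • s)) ∧
      (∀ (i : I) (c : Fin n) (f : Fin (m i c) → ((Σ i, (K i →+* ℂ)) → ℚ)), (∀ j, f j ∈ Ar c) →
        ∑ j, ι i c j (f j) = 0 → ∀ j, f j = 0) ∧
      (∀ i c j, b i c j ∈ Ar c) ∧
      (∀ i, antiVec (Φ i).1 (1 : ℂ ≃+* ℂ) = ∑ c, ∑ j, ι i c j (b i c j)) ∧
      (∀ c, a₀ c ∈ Ar c) ∧ (∀ c, a₀ c ≠ 0) ∧
      ∀ (i : I) (x₀ : K i →+* ℂ) (F : Submodule ℚ ((Σ i, (K i →+* ℂ)) → ℚ)),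
        (∀ f : (Σ i, (K i →+* ℂ)) → ℚ, f ∈ F ↔
          ∀ k : ℂ ≃+* ℂ, k • x₀ = x₀ → (fun y => f (k • y)) = f) →
        (IsNondegenerate (Φ i) ↔
          ∀ c, Ar c ≤ antiWeights (E := Σ i, (K i →+* ℂ)) (starRingAut : ℂ ≃+* ℂ) →
            Module.finrank ℚ ↥(⨆ j, (𝒟 c).map (LinearMap.applyₗ (b i c j))) =
              Module.finrank ℚ ↥(Ar c ⊓ F)) := by
  haveI : ∀ i, Nonempty (K i →+* ℂ) := fun i => inferInstance
  obtain ⟨n, Ar, 𝒟, m, ι, b, a₀, h𝒟, hRst, hRirr, hR0, hsep, hιeq, hind, hb, hu, ha₀, h0, hcrit⟩ :=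
    IrrOdd.exists_isotypic_typeRank_eq_iff_forall_odd_finrank_inf (G := ℂ ≃+* ℂ) (E := fun i => K i →+* ℂ)
      (Φ := fun i => (Φ i).1) fun i => isCMTypeWith_conj (Φ i)
  refine ⟨n, Ar, 𝒟, m, ι, b, a₀, h𝒟, hRst, hRirr, hR0, hsep, hιeq, hind, hb, hu, ha₀, h0, fun i x₀ F hF => ?_⟩
  rw [isNondegenerate_iff, ← NumberField.Embeddings.card (K i) ℂ]
  exact hcrit i x₀ (exists_smul_embedding_eq x₀) F hF

end Summit.HodgeConjecture.CorCM

end
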